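import Summits.RiemannHypothesis.RiemannHypothesis.Theorems.HardyZLehmerSplitDictionaryStubFarField
import Summits.RiemannHypothesis.RiemannHypothesis.Theorems.HardyZLehmerSplitDictionaryOfFarField
import HarnessLib

/-!
# Crux `Dictionary` of route `HardyZLehmerSplit` (stmt-RiemannHypothesis-24248), BY NAME

Stub B `StubFarField.stub_farField : ∀ t ≥ 100, |DictionaryV1.farSum t| ≤ 20 log t + 50`
(`HardyZLehmerSplitDictionaryStubFarField`) discharges the hypothesis of the landed composition
`DictionaryAssembly.Dictionary_of_farField` (stubs A, C, D, E landed; its `farSum` is the root-level copy of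
`HardyZLehmerSplitDictionarystub_partialFraction`, definitionally equal to `DictionaryV1.farSum`).
No `open` of `DictionaryV1` here: the root-level copies `kernel/window/farTerm/farSum` of the stub-A module
would make the short names ambiguous.  Nothing here bears on the truth of RH; RH is not proved.
-/

/-- **Crux `Dictionary` (stmt-RiemannHypothesis-24248) of route `HardyZLehmerSplit`, BY NAME.** -/
theorem DictionaryAssembly.dictionary_crux :
    Summit.RiemannHypothesis.RiemannHypothesis.Theses.HardyZLehmerSplit.Dictionary :=
  DictionaryAssembly.Dictionary_of_farField StubFarField.stub_farField
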